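import Mathlib
import HarnessLib
import HarnessLib.Audit
import Summits.AtomisticToContinuum.Statement

/-!
Route: AthermalWard

CLOSED (retired) 2026-08-15T13:38:28Z by operator:999:1257524 — reason: not-a-thesis: assembly does not conclude the sub-problem Statement — note: D-0027 §2.1 audit (human 2026-08-15: routes that do not decide the summit are removed): the assembly concludes `Literature.MathematicalPhysics.KineticTheory.HydrodynamicLimit`, not the sub-problem statement; a NEW conforming route may be opened from the same idea (generated `closes : … → _root_.Hydr. The file is kept as the record of this route; refuted decls are indexed as negative knowledge (`ledger negatives`).

# Route AthermalWard — heating is fast-forward — the athermal Ward identity makes d/dt of the mean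
fields one score covariance; one-direction response + entropy-saturated mean closure in the dilute
band

X = X_R ∧ X_M ∧ X_D ("it suffices to show"), realising card athermal-clock-ward-identity (spine;
uses (1)–(2)) with the
mean-closure step of card entropy-saturation-mean-closure and the packing dichotomy of route
ImplosionLoophole made explicit.
Hard spheres are athermal: S_c(x,v) = (x,cv) conjugates Φ_t to Φ_{ct} and pushes
localGibbsLaw(a,u,θ) to localGibbsLaw(a,cu,c²θ), so at
every finite N the mean fields V(t) = E_{LG}[U_N(Φ_t z)] satisfy the WARD IDENTITY t∂_tV + D′V =
Cov_{LG}(U_N(Φ_t z), K), D′ = diag(0,1,2),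
K = Σ_i[(|v_i|² − v_i·u₀(x_i))/θ₀(x_i) − 3] the initial energy score (support ScalingCovariance,
WardIdentity — provable now).
X_R (OneDirectionResponse, crux 2): in the dilute band that ONE covariance converges, uniformly on
[0,t], to (s∂_s + D′)U^E — one direction
of nonequilibrium linear response, the direction athermality identifies with ∂_t; by the identity
and an ODE in t this IS convergence of the
MEANS (target MeanHydroLimitInBand). X_M (MeanClosure, crux 3): means ⇒ probability, because
Liouville pins the Shannon entropy, local Gibbs
log-densities are linear in the fields and classical hs-Euler is isentropic. X_D
(DiluteSelfConsistency, crux 4, shared item 3091):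
admissible classical solutions stay at small packing, lifting the guards to the conjunct as typed.
Lean: `OneDirectionResponse ∧ MeanClosure ∧ DiluteSelfConsistency`

## Assembly
Measure theory + one t-integration, no physics (the finite-N identities carry the dynamics). Fix
profiles; η := min(η_R, η_M) from
OneDirectionResponse / MeanClosure; σ₀ := min(σ_R, σ_M, σ_D(η), 1/2) with σ_D from
DiluteSelfConsistency at η. For σ < σ₀, a classical
solution on [0,T), flows Φ, the t = 0 LLN and t ∈ (0,T) (at t = 0 the conclusion is the hypothesis):
DiluteSelfConsistency gives packing < η on
[0,T), so both cruxes apply; LocalGibbsStatics gives probability measures and E⟨e_N,1⟩ ≤ C, hence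
|E⟨m_N(Φ_s),χ⟩_j| ≤ ‖χ‖_∞(2C)^{1/2} and
|E⟨e_N(Φ_s),χ⟩| ≤ ‖χ‖_∞C for all s, N (energy conservation a.e. + Jensen). MOMENTUM: by WardIdentity
s ↦ sV_j(s) := s·E⟨m_N(Φ_s),χ⟩_j is
differentiable on (0,t] with derivative Cov_N(s) → c_j(s) = s g_j′(s) + g_j(s) uniformly on [0,t]
(OneDirectionResponse; g_j(s) = ∫χρ_s u_{s,j}
is C¹ on [0,t] ⊂ [0,T) by IsSmoothSpaceTimeOn, derivWithin (Ico 0 T) = its derivative), so tV_j(t) =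
lim_{s↓0}[sV_j(s)] + ∫₀^t Cov_N =
∫₀^t Cov_N → ∫₀^t (s g_j)′ = t g_j(t): V_j(t) → g_j(t). ENERGY: same with s²V_e, derivative
s·Cov_N^e(s) → s(s g_e′ + 2g_e) = (s²g_e)′.
DENSITY (smooth χ): MeanMassContinuity makes V_n C¹ on [0,∞) with V_n′(s) = Σ_j V_{∂_jχ,j}(s),
continuous and bounded by ‖∇χ‖_∞(2C)^{1/2};
by the momentum step with test functions ∂_jχ, V_{∂_jχ,j}(s) → ∫∂_jχ ρ_s u_{s,j} for every s ∈ (0,t]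
(uniformly on [t₁,t]), so
V_n(t) − V_n(0) = ∫₀^t V_n′ → ∫₀^t ∫Σ_j ∂_jχ ρ_s u_{s,j} = −∫₀^t∫χ div(ρ_s u_s) = ∫χρ_t − ∫χρ_0
(mass equation of IsHardSphereEulerSolution +
Torus.integral_divergence_eq_zero_holds / integration by parts on 𝕋³), and V_n(0) → ∫χρ_0 by the t =
0 LLN (|⟨n_N,χ⟩| ≤ ‖χ‖_∞, probability
measures). This is MeanHydroLimitInBand at (σ, t); MeanClosure turns it into TendstoHydroFieldsAt at
t; hydrodynamicLimit_iff closes.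

Rationale: WHY THIS LINE. The mechanism is an exact symmetry nobody cashed: for hard spheres temperature is
time, so the c-derivative of the exponential family
localGibbsLaw(a,cu,c²θ) — a covariance with the explicit score K — equals t∂_t + D′ of the mean
fields in closed form (card
athermal-clock-ward-identity; velocity-scaling generator conjugate to temperature about HOMOGENEOUS
states: DuftyBaskaranBrey2008 §7,
BaskaranDuftyJavierbrey2007; tilt-derivative form of EQUILIBRIUM time correlations: Spohn1991 §7.1
(7.16), pp. 88–89; ensemble shadow:
LebowitzPercusVerlet1967). It collapses the dynamical closure input to ONE direction of
conditional-mean response integrated in TIME from the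
t = 0 law of large numbers (OneDirectionResponse), where route OneParticleInfluence
(ScoreLinearResponse, stmt-3070) needs every score direction
uniformly along a homotopy of PROFILES plus an Efron–Stein variance leg, and where
RelEntropyErgodic/ChaoticMixing need a classification of
invariant states. Means suffice because the entropy budget is saturated (MeanClosure: Yau1991,
OllaVaradhanYau1993 Thm 1.1, KipnisLandim1999
Ch. 6, SaintRaymond2009 L.3.1.1; statics Ruelle1969, LebowitzPenrose1964, Georgii1994), so no
variance / two-marginal / Young-measure statement
(L2HydroFields 0800 of DenseKineticExpansion, DissipativeWeakStrong, OneParticleInfluence) is ever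
filed. Imported areas: Ward identities of a
scaling symmetry and score-function (likelihood-ratio) sensitivity from statistics (Glynn1990);
relative-entropy bookkeeping from stochastic
hydrodynamic limits; ballistic fluctuation theory only as the consumer of the exact finite-N clock
mode (ClockIdentity; DoyonEtAl2023,
DoyonEtAl2023PRL). The packing dichotomy is carried openly (DiluteSelfConsistency, shared with
ImplosionLoophole) instead of hidden in σ₀;
negatives index empty at filing.

RANKED CRUXES. #0 MeanHydroLimitInBand (target) — MEAN hydrodynamic limit in the dilute band (typed
waypoint): ∃ η > 0 such that for all continuous positive profiles ∃ σ₀ ∀ σ ∈ (0,σ₀), for every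
classical hs-Euler solution on [0,T) with packing ρ_t(x)σ³ < η on [0,T), every flow family with the
t = 0 LLN, every t < T and every smooth χ, the EXPECTATIONS under localGibbsLaw σ a₀ u₀ θ₀ N (Φ N)
of the empirical density / momentum (componentwise j) / energy fields of Φ_N,t z tested against χ
converge to ∫χρ_t, ∫χρ_t u_{t,j}, ∫χE_t. Delivered by OneDirectionResponse + WardIdentity +
MeanMassContinuity + LocalGibbsStatics (Assembly, first half); MeanClosure + DiluteSelfConsistency
turn it into the conjunct. (why it might fail: it is the packing-guarded conjunct restricted to
means (equivalent to it by entropy saturation): fails iff local equilibrium fails to propagate IN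
MEAN at fixed small σ before the shock (Spohn1991 I.3.1, "deep and highly non-obvious").)
[Spohn1991, OllaVaradhanYau1993]
#2 OneDirectionResponse (crux) — ONE-DIRECTION (ATHERMAL) RESPONSE (card C3, packing-guarded): ∃ η >
0, ∀ continuous positive profiles ∃ σ₀ ∀ σ ∈ (0,σ₀) ∀ classical hs-Euler solutions on [0,T) with
packing < η, ∀ flow families with the t = 0 LLN, ∀ t < T, ∀ smooth χ: with the initial ENERGY SCORE
K_N(z) = Σ_i[(|v_i|² − ⟪v_i,u₀(x_i)⟫)/θ₀(x_i) − 3] (the c-derivative at c = 1 of log localGibbsLaw σ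
a₀ (c u₀) (c²θ₀), mean zero) the covariances Cov_{LG_N}(K_N, ⟨m_N(Φ_{N,s} z),χ⟩_j) (j = 1,2,3) and
Cov_{LG_N}(K_N, ⟨e_N(Φ_{N,s} z),χ⟩) converge UNIFORMLY in s ∈ [0,t] to s∂_s∫χρ_s u_{s,j} + ∫χρ_s
u_{s,j} and s∂_s∫χE_s + 2∫χE_s, i.e. to (s∂_s + D′)U^E, D′ = diag(0,1,2). By exchangeability the
left side is (N+1)·E[κ(z₀)(E[F_s | z₀] − E F_s)]: the conditional-mean response of the time-s field
to ONE tagged sphere paired with the fixed weight κ — a single direction of nonequilibrium linear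
response, which WardIdentity identifies with ∂_s(sE⟨m_N(s),χ⟩_j), resp. s⁻¹∂_s(s²E⟨e_N(s),χ⟩), at
every finite N. [difficulty: open-problem] (why it might fail: By WardIdentity it is uniform-in-s
convergence of the MEAN momentum/energy fluxes to Euler's: false if one sphere's energy imprint
keeps an O(1) non-hydrodynamic part in conditional mean over N^{1/3} collision times, or if the
cubic energy current is not uniformly integrable.) [Spohn1991, DuftyBaskaranBrey2008,
OllaVaradhanYau1993, Duerinckx2021]
#3 MeanClosure (crux) — MEAN ⇒ PROBABILITY BY ENTROPY SATURATION (card C2; card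
entropy-saturation-mean-closure (a); packing-guarded): ∃ η > 0, ∀ continuous positive profiles ∃ σ₀
∀ σ ∈ (0,σ₀) ∀ classical hs-Euler solutions on [0,T) with packing < η, ∀ flow families with the t =
0 LLN, ∀ t < T: IF the expectations of the empirical density / momentum (componentwise) / energy
fields at time t converge for every smooth χ to ∫χρ_t, ∫χρ_t u_{t,j}, ∫χE_t, THEN
TendstoHydroFieldsAt holds at t. Mechanism: S(f_t) = S(f_0) (Liouville, lawAt_withDensity_holds),
log ψ[a,u,θ] is LINEAR in the empirical fields (hard core = common support, no pair energy),
classical hs-Euler is isentropic (Gibbs relation θds = de + p d(1/ρ) for p =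
ρθ·hsCompressibility(ρσ³)) ⇒ H(f_t | ψ[a_t,u_t,θ_t])/(N+1) = (linear statistic of the mean fields) +
o(1) → 0; then the entropy inequality against the exponential LLN of the reference local Gibbs law
(LocalGibbsConcentration 0767; assembly 0769 of RelEntropyErgodic). Static inputs at packing < η:
canonical inhomogeneous cluster expansion (limits of N⁻¹log Z_N(a) and N⁻¹S(ψ)), inverse
activity–density map, HsEosLowDensity 0768. [difficulty: L] (why it might fail: No dynamical
content; the risks are technical: a UNIFORM canonical (fixed N+1, inhomogeneous activity) cluster
expansion with O(log N/N) control, and exact isentropy needs hsExcessFreeEnergy ∈ C¹ on [0,η) so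
that the limsup/deriv EOS of HardSphereEuler.lean is the true one.) [Yau1991, OllaVaradhanYau1993,
KipnisLandim1999, SaintRaymond2009, Ruelle1969, LebowitzPenrose1964, Georgii1994]
#4 DiluteSelfConsistency (crux) — DILUTE SELF-CONSISTENCY (shared with route ImplosionLoophole,
stmt-AtomisticToContinuum-3091, identical signature): for every η > 0 and all continuous positive
profiles ∃ σ₀ such that for σ ∈ (0,σ₀) every classical hs-Euler solution on [0,T) whose t = 0 fields
are the LLN limit of the local Gibbs laws has packing ρ_t(x)σ³ < η for all t < T, x. Needed because
in the conjunct σ₀ depends on the profiles only while T and the solution are quantified after σ; it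
lifts the packing guards of OneDirectionResponse and MeanClosure to the conjunct as typed.
[difficulty: open-problem] (why it might fail: DenseExcursion (smooth self-similar implosion tracked
by the σ-family; ImplosionLoophole crux 2) refutes it outright; even if true it asks σ-uniform
density control at the first singularity for ALL smooth profiles (generic-singularity problem).)
[Sideris1985, LukSpeck2024, CaolaboraEtAl2025, BuckmasterCaolaboraGomezserrano2025, Spohn1991]
#9 ScalingCovariance (support) — MASTER IDENTITY (H) at the level of laws: for σ > 0, c > 0, t ≥ 0,
continuous profiles with θ₀ > 0, every N and flow Φ: lawAt Φ (localGibbsLaw σ a₀ (c·u₀) (c²θ₀) N Φ)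
t = (S_c)_# lawAt Φ (localGibbsLaw σ a₀ u₀ θ₀ N Φ) (c t), S_c(x_i,v_i) = (x_i, c v_i) — "a hotter
copy at time t is the original at time ct". Proof: (S_c)_# LG(a,u,θ) = LG(a,cu,c²θ) (Gaussian change
of variables; the configurational factor Π a(x_i)·1_D and Z_N are untouched) and Φ_t ∘ S_c = S_c ∘
Φ_{ct} Liouville-a.e. (S_c maps hard-sphere trajectories to time-rescaled ones: free flight is
linear, contact / incoming conditions and collidePair are 1-homogeneous in the velocities;
IsHardSphereTrajectory.unique_holds on good ∩ S_c⁻¹good, conull since S_c preserves Liouville-null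
sets). Rests on PROVED cone facts only. [difficulty: provable-now] [DuftyBaskaranBrey2008, GST2013,
Alexander1975, CIP1994]
#9 WardIdentity (support) — WARD IDENTITIES (W_H) at finite N, derivative form: for σ > 0, t > 0,
continuous positive profiles, N, Φ and continuous χ, with P = localGibbsLaw σ a₀ u₀ θ₀ N Φ and K(z)
= Σ_i[(|v_i|² − ⟪v_i,u₀(x_i)⟫)/θ₀(x_i) − 3]: s ↦ E_P⟨n_N(Φ_s z),χ⟩ has derivative t⁻¹Cov_P(K,
⟨n_N(Φ_t ·),χ⟩) at t; s ↦ s·E_P⟨m_N(Φ_s ·),χ⟩_j has derivative Cov_P(K, ⟨m_N(Φ_t ·),χ⟩_j) at t (each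
j); s ↦ s²·E_P⟨e_N(Φ_s ·),χ⟩ has derivative t·Cov_P(K, ⟨e_N(Φ_t ·),χ⟩) at t — i.e. t∂_tV + D′V =
Cov(·, K). Proof: expectations of the (0,1,2)-homogeneous fields in ScalingCovariance give
E_{LG(a,cu,c²θ)}F(U(t)) = E_{LG}F(D_cU(ct)); the left side is an exponential family in c
(differentiate under ∫: Gaussian tails × energy-bounded fields), its c-derivative at 1 is the
covariance with the score K; the right side gives D′V(t) + t∂_tV(t), and differentiability of V in t
> 0 comes for free because t enters only through c. [difficulty: provable-now]
[DuftyBaskaranBrey2008, LebowitzPercusVerlet1967, Glynn1990, Spohn1991]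
#9 MeanMassContinuity (support) — exact MEAN continuity equation at finite N (no collision term ever
enters the mass flux): for σ > 0, continuous positive profiles, N, Φ and smooth χ, with P the local
Gibbs law: h(s) := E_P Σ_j⟨m_N(Φ_s z), ∂_jχ⟩_j is continuous on [0,∞) and s ↦ E_P⟨n_N(Φ_s z),χ⟩ has
derivative h(t) within [0,∞) at every t ≥ 0. Proof: positions are continuous and piecewise free
(IsHardSphereTrajectory: pos_continuous, free, locFinite), so pathwise ⟨n_N(Φ_t z),χ⟩ − ⟨n_N(z),χ⟩ =
∫₀^t Σ_j⟨m_N(Φ_s z),∂_jχ⟩_j ds for good z with integrand bounded by ‖∇χ‖_∞(2⟨e_N(z),1⟩)^{1/2}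
(energy conservation, configEnergy_eq_holds; Cauchy–Schwarz); dominated convergence of difference
quotients; continuity of h because a collision at a FIXED time has probability 0 (contact sets are
Liouville-null, Φ_s is measure preserving). [difficulty: provable-now] [Spohn1991, GST2013,
IrvingKirkwood1950]
#9 LocalGibbsStatics (support) — for continuous positive profiles and 0 < σ < 1/2: every
localGibbsLaw σ a₀ u₀ θ₀ N Φ is a probability measure (Z_N > 0: N+1 centres of spheres of diameter
σ(N+1)^{-1/3} fit on a cubic lattice of mesh ⌈(N+1)^{1/3}⌉⁻¹ > diameter with slack, a₀ > 0
continuous), and the mean kinetic energy per particle E⟨e_N,1⟩ is finite and ≤ C := sup|u₀|²/2 +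
(3/2)sup θ₀ uniformly in N and Φ (velocities are conditionally independent Maxwellians
M_{u₀(x_i),θ₀(x_i)} given the positions). Supplies IsProbabilityMeasure and the uniform L¹/UI bounds
the Assembly needs; strengthens the satisfiability half of Literature fact localGibbs_lln.
[difficulty: provable-now] [Ruelle1969, GST2013, Spohn1991]
#9 ClockIdentity (support) — CLOCK MODE, exact at finite N (card use (2)): for isothermal data at
rest (u₀ ≡ 0, θ₀ ≡ θc > 0, any continuous a₀ > 0 — e.g. a density pulse), σ > 0, t > 0, N, Φ,
continuous χ, P the local Gibbs law: (2/θc)(N+1)·Cov_P(⟨n_N(Φ_t z),χ⟩, ⟨e_N(Φ_t z),1⟩) =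
t·(d/dt)E_P⟨n_N(Φ_t z),χ⟩ — the EQUAL-TIME covariance of the local density with the total kinetic
energy per particle equals (θc/2N)·t·∂_t of the mean density: the total-energy fluctuation is a
random clock rate. From WardIdentity (density clause) with K = (2/θc)(N+1)⟨e_N,1⟩ − 3(N+1) for these
profiles and conservation of ⟨e_N,1⟩ along the flow (a.e.). Corollary left to tenure: under the
conjunct the right side → (θc/2)t∂_t∫χρ_t (t × mean mass flux), an O(1/N) LONG-RANGE density–energy
correlation growing linearly in t, present for canonical and absent for microcanonical local Gibbs
data — an EOS-free event-driven-MD test of the conjunct and an ensemble-dependent mode any BMFT-type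
fluctuation target for hard spheres must carry. [difficulty: provable-now]
[LebowitzPercusVerlet1967, DoyonEtAl2023, DoyonEtAl2023PRL, Glynn1990]

TWO-LAYER PLAN. Foreseen glued splits (nothing filed now; k ≤ 3, depth 1): OneDirectionResponse ⇐
StaticDirection (s = 0: Cov → D′U₀ = (0, ρ₀u₀, 2E₀), Gaussian
statics + t = 0 LLN, provable now) → OneParticleEnergyGreen (the conserved-density projection of the
one-particle influence function m_s paired
with κ is transported by linearised hs-Euler about the solution; needs definition LinearizedHsEuler
already requested by route
OneParticleInfluence) → OneDirectionResponse (glue: Cauchy–Schwarz + chain rule). MeanClosure ⇐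
EntropySaturationIdentity (card
entropy-saturation-mean-closure crux 2: |klDiv(lawAt … t ‖ ψ[a_t,u_t,θ_t])/(N+1) − Θ_N(t)| → 0) →
GuardedGibbsConcentration (0767 with the
packing guard and a C^k-ball of profiles) → MeanClosure (glue = entropy inequality, as assembly
0769). The Assembly itself factors as
(OneDirectionResponse, WardIdentity, MeanMassContinuity, LocalGibbsStatics ⇒ MeanHydroLimitInBand)
and (MeanHydroLimitInBand, MeanClosure,
DiluteSelfConsistency ⇒ conjunct); a prover may land either half with --supports Assembly.

KILL CRITERIA. ¬OneDirectionResponse at some fixed small σ before the shock (an N-independent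
non-Euler part of Cov(K_N, ⟨m_N(s),χ⟩), i.e. of the mean momentum
flux, by MD extrapolation or analysis) closes the route `refuted:OneDirectionResponse` AND, with
MeanClosure, is a summit-level negative for the
guarded conjunct — record it in the negatives index. DenseExcursion proved by ImplosionLoophole
refutes DiluteSelfConsistency: the route goes
BROKEN together with every cluster-expansion route; repair = `--restate`/`--drop`
DiluteSelfConsistency and re-target the Assembly to the
operator's guarded conjunct (audit D5) — the two remaining cruxes are already guarded, so nothing
else changes. ¬MeanClosure cannot happen
without an error in the statics or a junk-value defect of hsPressure / klDiv typing: treat as an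
operator alarm, not a pivot. ScalingCovariance /
WardIdentity / ClockIdentity refuted = a typing slip in a three-line identity: restate at once.
L2HydroFields (0800) or RelEntropyVanishing (0766)
proved by any route moots the Assembly (MeanHydroLimitInBand and ClockIdentity keep independent
value); HydroLimitInBand (3093) proved elsewhere
moots everything but DiluteSelfConsistency.

NOT DECOMPOSED YET. The layer-2 children above (StaticDirection, OneParticleEnergyGreen,
EntropySaturationIdentity, GuardedGibbsConcentration); the boost Ward
identity (W_G) (Cov with the momentum score P = Σ(v_i − u₀)/θ₀ equals t⟨V,∂_aχ⟩ + G′_aV, no time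
derivative) and the pressure-free covariance
form of the momentum closure (card use (3)) — filed only if a prover wants them as tools; the typed
negative corollary HydroLimitInBand →
ClockLaw (pointwise in t it needs uniform integrability of the collisional flux; time-integrated it
is unconditional); real-analyticity of
t ↦ E_{LG}F(U_N(t)) at fixed N (card (3b)); any rate in N (O(Kn) = O(N^{-1/3}) expected); the
pathwise continuity equation and the
no-atom-of-collision-times lemma (helpers of MeanMassContinuity, attached with --supports); d = 3
only.

CHEAPEST FALSIFIER. (i) Free flight (BoltzmannHypothesis kernel idealGasState): Cov(K, ⟨m_N(s),χ⟩)
is explicit — ballistic transport of the κ-imprint — and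
≠ (s∂_s + 1)(ρu)^E: the crux is not vacuous and fails exactly where Euler fails; for u₀, θ₀ constant
both sides agree trivially (on paper:
Cov_M(v_j,κ) = u_j, Cov_M(|v|²/2,κ) = |u|² + 3θ = 2E/ρ, E_M κ = 0). (ii) A grounder re-derives (W_H)
in five lines from (H) (on paper:
d/dc log M_{cu,c²θ}(v)|_{c=1} = (|v|² − v·u)/θ − 3). (iii) Event-driven MD, φ = 0.05, N = 10³–10⁴,
isothermal density pulse at rest:
(2/θ)(N+1)Cov(cell density, ⟨e_N,1⟩) vs t × finite-difference d/dt of the mean cell density —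
ClockIdentity is EXACT at finite N (code check +
visibility of the clock mode at CLT scale), then the likelihood-ratio ∂_t-estimator with weight K vs
finite differences (kit not in this seat).
(iv) Lookup: (W_H) for INHOMOGENEOUS nonequilibrium hard-sphere flows in print? (DBB 2006–08:
generator form about the homogeneous cooling
state; LPV 1967: equilibrium shadow; Spohn (7.16): equilibrium tilt) — a hit lowers novelty, not
validity.

NUMBERS. Fixed reduced density (N+1)ε³ = σ³; Kn ≍ (N+1)^{-1/3}, expected finite-N corrections to
OneDirectionResponse of relative size O(Kn) (Navier–Stokes
order). Score statistics under LG: E K = 0, Var K = (N+1)·E[6 + |u₀(x)|²/θ₀(x)] = O(N); Var⟨m_N,χ⟩ =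
O(1/N) expected, so the Ward covariance is
O(1) = √N × N^{-1/2} (CLT scale on both factors). D′ = diag(0,1,2); static value Cov(K,U_N(0)) → (0,
ρ₀u₀, 2E₀). Clock mode:
(N+1)Cov(⟨n_N,χ⟩,⟨e_N,1⟩) → (θ/2)·t·∂_t∫χρ_t, linear in t, O(1). Packing guard η: any value below
the radius η₀ of HsEosLowDensity (0768) /
LocalGibbsConcentration (0767) works for MeanClosure; hard-sphere freezing at packing fraction ≈
0.49 and close packing 0.7405 are far outside.
Items at open: 10 (1 target, 3 cruxes — one shared with ImplosionLoophole —, 5 support, 1 assembly).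

DEFINITION REQUESTS. None to type the ten items (HardSphereEuler.lean objects + Mathlib
ProbabilityTheory.covariance, HasDerivAt, TendstoUniformlyOn,
Measure.map). Layer 2 (OneParticleEnergyGreen) will reuse the definition LinearizedHsEuler requested
by route OneParticleInfluence
(topic Literature/Analysis/FluidPDE). No cite facts requested: the identities are proved from the
cone, and MeanClosure's statics are
shared items 0767/0768 rather than named facts.

Novelty: Searches (2026-08-15): `lit search --hybrid "hard spheres temperature time scale velocity scaling
correlation functions derivative with
respect to temperature"` (12 book rows; Spohn1991 pp. 53, 58, 81; none with a two-time identity);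
`lit vsearch` of the scaling statement in
prose (10, none relevant); `lit search --source crossref "Linear response and hydrodynamics for
granular fluids Dufty Baskaran Brey"` (8:
doi:10.1103/physreve.77.031310, doi:10.1088/1742-5468/2006/08/l08002,
doi:10.1088/1742-5468/2007/12/p12002, …) and `lit read
doi:10.1103/physreve.77.031310` pp. 12, 23–24 (§7 "scaling limit": all temperature dependence
through velocity scaling, exact for hard
spheres; T∂_T ↔ scaling generator, about the homogeneous cooling state); crossref "homogeneity of
the hard sphere Liouville operator velocity
scaling time temperature superposition" (10: MD velocity-rescaling thermostats, Erpenbeck–Wood 1985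
VACF; nothing nonequilibrium-exact);
crossref for LPV 1967 (doi:10.1103/physrev.153.250), Glynn 1990 (doi:10.1145/84537.84552), BMFT
(doi:10.21468/scipostphys.15.4.136,
doi:10.1103/physrevlett.131.027101, doi:10.1088/1742-5468/adfe57); `lit read` Spohn1991 pp. 88–89
((7.16): equilibrium time covariance =
λ-derivative of the hydrodynamic mean of an exponentially TILTED local equilibrium state — the
tilt/score trick, at equilibrium, generic tilt);
`lit frontier AtomisticToContinuum --since 2020` (30; arXiv:2310.13338 heat equation from a
deterministic dynamics; nothing on scaling  [refs: 10.1103/physreve.77.031310, 10.1088/1742-5468/2006/08/l08002, 10.1088/1742-5468/2007/12/p12002, 10.1103/physreve.77.031310`, 10.1103/physrev.153.250, 10.1145/84537.84552, 10.21468/scipostphys.15.4.136, 10.1103/physrevlett.131.027101, 10.1088/1742-5468/adfe57, 2310.13338, doi:10.1103/physreve.77.031310, doi:10.1088/1742-5468/2006/08/l08002, doi:10.1088/1742-5468/2007/12/p12002, doi:10.1103/physrev.]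

Barriers (technique_class: exact-response-identity scaling-covariance score-function): - technique_class: exact-response-identity scaling-covariance score-function
- Literature.Barriers.AtomisticToContinuum.BoltzmannHypothesisBarrier: NOT evaded by
OneDirectionResponse — identifying the one-direction response (= the mean momentum/energy flux, by
WardIdentity) is the closure problem in its weakest form (mean, one scalar direction κ, pre-shock),
and the crux visibly FAILS for the barrier's ideal-gas kernel idealGasState (free flight transports
the κ-imprint ballistically); the bet is that one direction of conditional-mean response about the
true flow is the smallest carrier of local equilibrium on the board. MeanClosure evades the
barrier's classification-of-invariant-states form entirely: entropy is saturated by Liouville +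
isentropy, no stationary-state input.
- Literature.Barriers.AtomisticToContinuum.MacroErgodicityBarrier: same status as above — no ergodic
decomposition of the infinite-volume dynamics is invoked anywhere; the only dynamical input is a
finite-N covariance limit (OneDirectionResponse).
- Literature.Barriers.AtomisticToContinuum.VelocityReversalBarrier: not met — statements are about
laws, expectations and covariances under the INITIAL local Gibbs law, and the conclusion at time t
(in probability) is weaker than the hypothesis structure at t = 0; (H) at c = −1 composed with t ↦
−t is exactly Loschmidt's symmetry and is used only for c > 0.
- Literature.Barriers.AtomisticToContinuum.HighMomentumCutoffBarrier: not met by the identities (K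
has Gau

History (route lifecycle, newest last):
- 2026-08-15T13:38:28Z · CLOSED retired — not-a-thesis: assembly does not conclude the sub-problem Statement (operator:999:1257524)

sub-problem: HydrodynamicLimit · status: closed(retired) · opened planner-plancard-AtomisticToContinuum-Hydrody-8edbff45-0 2026-08-15T11:46:21Z · rev 1 · ledger route-AtomisticToContinuum-AthermalWard
GENERATED by the gate from the ledger (D-0016/17). Provers cite these decls: `theorem foo : Summit.AtomisticToContinuum.HydrodynamicLimit.Theses.AthermalWard.<Decl> := …` in Summits/AtomisticToContinuum/HydrodynamicLimit/Theorems/<Name>.lean.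
-/

namespace Summit.AtomisticToContinuum.HydrodynamicLimit.Theses.AthermalWard

open scoped BigOperators Topology Manifold Classical MeasureTheory ProbabilityTheory Matrix InnerProductSpace ComplexConjugate ContinuousMap
open Filter Set Function TopologicalSpace MeasureTheory

attribute [summit_statement] _root_.HydrodynamicLimit

/-- item stmt-AtomisticToContinuum-6384 · target · rank 0 · closed · moot by None · by planner
why it might fail: it is the packing-guarded conjunct restricted to means (equivalent to it by entropy saturation): fails iff local equilibrium fails to propagate IN MEAN at fixed small σ before the shock (Spohn1991 I.3.1, "deep and highly non-obvious").
sources: Spohn1991, OllaVaradhanYau1993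
[target] MEAN hydrodynamic limit in the dilute band (typed waypoint): ∃ η > 0 such that for all
continuous positive profiles ∃ σ₀ ∀ σ ∈ (0,σ₀), for every classical hs-Euler solution on [0,T) with
packing ρ_t(x)σ³ < η on [0,T), every flow family with the t = 0 LLN, every t < T and every smooth χ,
the EXPECTATIONS under localGibbsLaw σ a₀ u₀ θ₀ N (Φ N) of the empirical density / momentum
(componentwise j) / energy fields of Φ_N,t z tested against χ converge to ∫χρ_t, ∫χρ_t u_{t,j},
∫χE_t. Delivered by OneDirectionResponse + WardIdentity + MeanMassContinuity + LocalGibbsStatics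
(Assembly, first half); MeanClosure + DiluteSelfConsistency turn it into the conjunct. -/
@[route_item "route-AtomisticToContinuum-AthermalWard"]
def MeanHydroLimitInBand : Prop :=
  ∃ η : ℝ, 0 < η ∧ ∀ (a₀ θ₀ : Literature.MathematicalPhysics.KineticTheory.T3 → ℝ) (u₀ : Literature.MathematicalPhysics.KineticTheory.T3 → Literature.MathematicalPhysics.KineticTheory.V3), Continuous a₀ → Continuous θ₀ → Continuous u₀ → (∀ x, 0 < a₀ x) → (∀ x, 0 < θ₀ x) → ∃ σ₀ : ℝ, 0 < σ₀ ∧ ∀ σ : ℝ, 0 < σ → σ < σ₀ → ∀ (T : ℝ) (ρ θ : ℝ → Literature.MathematicalPhysics.KineticTheory.T3 → ℝ) (u : ℝ → Literature.MathematicalPhysics.KineticTheory.T3 → Literature.MathematicalPhysics.KineticTheory.V3), Literature.MathematicalPhysics.KineticTheory.IsHardSphereEulerSolution σ T ρ u θ → (∀ t ∈ Set.Ico 0 T, ∀ x, ρ t x * σ ^ 3 < η) → ∀ Φ : (N : ℕ) → Literature.Analysis.FluidPDE.HardSphereFlow (Literature.Analysis.FluidPDE.Torus.geometry (Fin 3))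 (Literature.MathematicalPhysics.KineticTheory.hsDiameter σ N) (N + 1), Literature.MathematicalPhysics.KineticTheory.TendstoHydroFieldsAt (fun N => Literature.MathematicalPhysics.KineticTheory.localGibbsLaw σ a₀ u₀ θ₀ N (Φ N)) Φ ρ u θ 0 → ∀ t ∈ Set.Ico 0 T, ∀ χ : Literature.MathematicalPhysics.KineticTheory.T3 → ℝ, Literature.Analysis.FunctionSpaces.Torus.IsSmooth χ → Filter.Tendsto (fun N : ℕ => ∫ z, Literature.MathematicalPhysics.KineticTheory.empiricalDensityField ((Φ N).flow t z) χ ∂(Literature.MathematicalPhysics.KineticTheory.localGibbsLaw σ a₀ u₀ θ₀ N (Φ N))) Filter.atTop (nhds (∫ x, χ x * ρ t x)) ∧ (∀ j : Fin 3, Filter.Tendsto (fun N : ℕ => ∫ z, Literature.MathematicalPhysics.KineticTheory.empiricalMomentumField ((Φ N).flow t z) χ j ∂(Literature.MathematicalPhysics.KineticTheory.localGibbsLaw σ a₀ u₀ θ₀ N (Φ N))) Filter.atTop (nhds (∫ x, χ x * ρ t x * u t x j))) ∧ Filter.Tendsto (fun N : ℕ => ∫ z, Literature.MathematicalPhysics.KineticTheory.empiricalEnergyField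 ((Φ N).flow t z) χ ∂(Literature.MathematicalPhysics.KineticTheory.localGibbsLaw σ a₀ u₀ θ₀ N (Φ N))) Filter.atTop (nhds (∫ x, χ x * Literature.MathematicalPhysics.KineticTheory.totalEnergyDensity (ρ t x) (u t x) (θ t x)))

/-- item stmt-AtomisticToContinuum-6385 · crux · rank 2 · closed · moot by None · by planner
why it might fail: By WardIdentity it is uniform-in-s convergence of the MEAN momentum/energy fluxes to Euler's: false if one sphere's energy imprint keeps an O(1) non-hydrodynamic part in conditional mean over N^{1/3} collision times, or if the cubic energy current is not uniformly integrable.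
sources: Spohn1991, DuftyBaskaranBrey2008, OllaVaradhanYau1993, Duerinckx2021
[crux] ONE-DIRECTION (ATHERMAL) RESPONSE (card C3, packing-guarded): ∃ η > 0, ∀ continuous positive
profiles ∃ σ₀ ∀ σ ∈ (0,σ₀) ∀ classical hs-Euler solutions on [0,T) with packing < η, ∀ flow families
with the t = 0 LLN, ∀ t < T, ∀ smooth χ: with the initial ENERGY SCORE K_N(z) = Σ_i[(|v_i|² −
⟪v_i,u₀(x_i)⟫)/θ₀(x_i) − 3] (the c-derivative at c = 1 of log localGibbsLaw σ a₀ (c u₀) (c²θ₀), mean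
zero) the covariances Cov_{LG_N}(K_N, ⟨m_N(Φ_{N,s} z),χ⟩_j) (j = 1,2,3) and Cov_{LG_N}(K_N,
⟨e_N(Φ_{N,s} z),χ⟩) converge UNIFORMLY in s ∈ [0,t] to s∂_s∫χρ_s u_{s,j} + ∫χρ_s u_{s,j} and
s∂_s∫χE_s + 2∫χE_s, i.e. to (s∂_s + D′)U^E, D′ = diag(0,1,2). By exchangeability the left side is
(N+1)·E[κ(z₀)(E[F_s | z₀] − E F_s)]: the conditional-mean response of the time-s field to ONE tagged
sphere paired with the fixed weight κ — a single direction of nonequilibrium linear response, which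
WardIdentity identifies with ∂_s(sE⟨m_N(s),χ⟩_j), resp. s⁻¹∂_s(s²E⟨e_N(s),χ⟩), at every finite N.
[difficulty: open-problem] -/
@[route_item "route-AtomisticToContinuum-AthermalWard"]
def OneDirectionResponse : Prop :=
  ∃ η : ℝ, 0 < η ∧ ∀ (a₀ θ₀ : Literature.MathematicalPhysics.KineticTheory.T3 → ℝ) (u₀ : Literature.MathematicalPhysics.KineticTheory.T3 → Literature.MathematicalPhysics.KineticTheory.V3), Continuous a₀ → Continuous θ₀ → Continuous u₀ → (∀ x, 0 < a₀ x) → (∀ x, 0 < θ₀ x) → ∃ σ₀ : ℝ, 0 < σ₀ ∧ ∀ σ : ℝ, 0 < σ → σ < σ₀ → ∀ (T : ℝ) (ρ θ : ℝ → Literature.MathematicalPhysics.KineticTheory.T3 → ℝ) (u : ℝ → Literature.MathematicalPhysics.KineticTheory.T3 → Literature.MathematicalPhysics.KineticTheory.V3), Literature.MathematicalPhysics.KineticTheory.IsHardSphereEulerSolution σ T ρ u θ → (∀ t ∈ Set.Ico 0 T, ∀ x, ρ t x * σ ^ 3 < η) → ∀ Φ : (N : ℕ) → Literature.Analysis.FluidPDE.HardSphereFlow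 (Literature.Analysis.FluidPDE.Torus.geometry (Fin 3)) (Literature.MathematicalPhysics.KineticTheory.hsDiameter σ N) (N + 1), Literature.MathematicalPhysics.KineticTheory.TendstoHydroFieldsAt (fun N => Literature.MathematicalPhysics.KineticTheory.localGibbsLaw σ a₀ u₀ θ₀ N (Φ N)) Φ ρ u θ 0 → ∀ t ∈ Set.Ico 0 T, ∀ χ : Literature.MathematicalPhysics.KineticTheory.T3 → ℝ, Literature.Analysis.FunctionSpaces.Torus.IsSmooth χ → let P : (N : ℕ) → MeasureTheory.Measure (Literature.Analysis.FluidPDE.Config (N + 1) (Fin 3) Literature.MathematicalPhysics.KineticTheory.T3) := fun N => Literature.MathematicalPhysics.KineticTheory.localGibbsLaw σ a₀ u₀ θ₀ N (Φ N); let K : (N : ℕ) → Literature.Analysis.FluidPDE.Config (N + 1) (Fin 3) Literature.MathematicalPhysics.KineticTheory.T3 → ℝ := fun _ z => ∑ i, ((‖(z i).2‖ ^ 2 - ⟪(z i).2, u₀ (z i).1⟫_ℝ) / θ₀ (z i).1 - 3); (∀ j : Fin 3, TendstoUniformlyOn (fun (N : ℕ) (s : ℝ) => ProbabilityTheory.covariance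 (K N) (fun z => Literature.MathematicalPhysics.KineticTheory.empiricalMomentumField ((Φ N).flow s z) χ j) (P N)) (fun s => s * derivWithin (fun s' => ∫ x, χ x * ρ s' x * u s' x j) (Set.Ico 0 T) s + ∫ x, χ x * ρ s x * u s x j) Filter.atTop (Set.Icc 0 t)) ∧ TendstoUniformlyOn (fun (N : ℕ) (s : ℝ) => ProbabilityTheory.covariance (K N) (fun z => Literature.MathematicalPhysics.KineticTheory.empiricalEnergyField ((Φ N).flow s z) χ) (P N)) (fun s => s * derivWithin (fun s' => ∫ x, χ x * Literature.MathematicalPhysics.KineticTheory.totalEnergyDensity (ρ s' x) (u s' x) (θ s' x)) (Set.Ico 0 T) s + 2 * ∫ x, χ x * Literature.MathematicalPhysics.KineticTheory.totalEnergyDensity (ρ s x) (u s x) (θ s x)) Filter.atTop (Set.Icc 0 t)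

/-- item stmt-AtomisticToContinuum-6386 · crux · rank 3 · closed · moot by None · by planner
why it might fail: No dynamical content; the risks are technical: a UNIFORM canonical (fixed N+1, inhomogeneous activity) cluster expansion with O(log N/N) control, and exact isentropy needs hsExcessFreeEnergy ∈ C¹ on [0,η) so that the limsup/deriv EOS of HardSphereEuler.lean is the true one.
sources: Yau1991, OllaVaradhanYau1993, KipnisLandim1999, SaintRaymond2009, Ruelle1969, LebowitzPenrose1964
[crux] MEAN ⇒ PROBABILITY BY ENTROPY SATURATION (card C2; card entropy-saturation-mean-closure (a);
packing-guarded): ∃ η > 0, ∀ continuous positive profiles ∃ σ₀ ∀ σ ∈ (0,σ₀) ∀ classical hs-Euler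
solutions on [0,T) with packing < η, ∀ flow families with the t = 0 LLN, ∀ t < T: IF the
expectations of the empirical density / momentum (componentwise) / energy fields at time t converge
for every smooth χ to ∫χρ_t, ∫χρ_t u_{t,j}, ∫χE_t, THEN TendstoHydroFieldsAt holds at t. Mechanism:
S(f_t) = S(f_0) (Liouville, lawAt_withDensity_holds), log ψ[a,u,θ] is LINEAR in the empirical fields
(hard core = common support, no pair energy), classical hs-Euler is isentropic (Gibbs relation θds =
de + p d(1/ρ) for p = ρθ·hsCompressibility(ρσ³)) ⇒ H(f_t | ψ[a_t,u_t,θ_t])/(N+1) = (linear statistic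
of the mean fields) + o(1) → 0; then the entropy inequality against the exponential LLN of the
reference local Gibbs law (LocalGibbsConcentration 0767; assembly 0769 of RelEntropyErgodic). Static
inputs at packing < η: canonical inhomogeneous cluster expansion (limits of N⁻¹log Z_N(a) and
N⁻¹S(ψ)), inverse activity–density map, HsEosLowDensity 0768. [difficulty: L] -/
@[route_item "route-AtomisticToContinuum-AthermalWard"]
def MeanClosure : Prop :=
  ∃ η : ℝ, 0 < η ∧ ∀ (a₀ θ₀ : Literature.MathematicalPhysics.KineticTheory.T3 → ℝ) (u₀ : Literature.MathematicalPhysics.KineticTheory.T3 → Literature.MathematicalPhysics.KineticTheory.V3), Continuous a₀ → Continuous θ₀ → Continuous u₀ → (∀ x, 0 < a₀ x) → (∀ x, 0 < θ₀ x) → ∃ σ₀ : ℝ, 0 < σ₀ ∧ ∀ σ : ℝ, 0 < σ → σ < σ₀ → ∀ (T : ℝ) (ρ θ : ℝ → Literature.MathematicalPhysics.KineticTheory.T3 → ℝ) (u : ℝ → Literature.MathematicalPhysics.KineticTheory.T3 → Literature.MathematicalPhysics.KineticTheory.V3), Literature.MathematicalPhysics.KineticTheory.IsHardSphereEulerSolution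 σ T ρ u θ → (∀ t ∈ Set.Ico 0 T, ∀ x, ρ t x * σ ^ 3 < η) → ∀ Φ : (N : ℕ) → Literature.Analysis.FluidPDE.HardSphereFlow (Literature.Analysis.FluidPDE.Torus.geometry (Fin 3)) (Literature.MathematicalPhysics.KineticTheory.hsDiameter σ N) (N + 1), Literature.MathematicalPhysics.KineticTheory.TendstoHydroFieldsAt (fun N => Literature.MathematicalPhysics.KineticTheory.localGibbsLaw σ a₀ u₀ θ₀ N (Φ N)) Φ ρ u θ 0 → ∀ t ∈ Set.Ico 0 T, (∀ χ : Literature.MathematicalPhysics.KineticTheory.T3 → ℝ, Literature.Analysis.FunctionSpaces.Torus.IsSmooth χ → Filter.Tendsto (fun N : ℕ => ∫ z, Literature.MathematicalPhysics.KineticTheory.empiricalDensityField ((Φ N).flow t z) χ ∂(Literature.MathematicalPhysics.KineticTheory.localGibbsLaw σ a₀ u₀ θ₀ N (Φ N))) Filter.atTop (nhds (∫ x, χ x * ρ t x)) ∧ (∀ j : Fin 3, Filter.Tendsto (fun N : ℕ => ∫ z, Literature.MathematicalPhysics.KineticTheory.empiricalMomentumField ((Φ N).flow t z) χ j ∂(Literature.MathematicalPhysics.KineticTheory.localGibbsLaw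 σ a₀ u₀ θ₀ N (Φ N))) Filter.atTop (nhds (∫ x, χ x * ρ t x * u t x j))) ∧ Filter.Tendsto (fun N : ℕ => ∫ z, Literature.MathematicalPhysics.KineticTheory.empiricalEnergyField ((Φ N).flow t z) χ ∂(Literature.MathematicalPhysics.KineticTheory.localGibbsLaw σ a₀ u₀ θ₀ N (Φ N))) Filter.atTop (nhds (∫ x, χ x * Literature.MathematicalPhysics.KineticTheory.totalEnergyDensity (ρ t x) (u t x) (θ t x)))) → Literature.MathematicalPhysics.KineticTheory.TendstoHydroFieldsAt (fun N => Literature.MathematicalPhysics.KineticTheory.localGibbsLaw σ a₀ u₀ θ₀ N (Φ N)) Φ ρ u θ t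

/-- item stmt-AtomisticToContinuum-3091 · crux · rank 4 · open · by planner
why it might fail: DenseExcursion (smooth self-similar implosion tracked by the σ-family; ImplosionLoophole crux 2) refutes it outright; even if true it asks σ-uniform density control at the first singularity for ALL smooth profiles (generic-singularity problem).
sources: Sideris1985, LukSpeck2024, CaolaboraEtAl2025, BuckmasterCaolaboraGomezserrano2025, Spohn1991
[crux] (card crux 1B ∪ 3; the hidden PDE crux of every route) for every η > 0 and all continuous
positive profiles there is σ₀ > 0 such that for 0 < σ < σ₀, every classical hard-sphere-Euler
solution on [0,T) whose t = 0 fields are the LLN limit of the local Gibbs laws satisfies ρ_t(x)σ³ <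
η for all t < T and x — i.e. limsup_{σ→0} σ³ sup_{t<T*_σ} ‖ρ_σ(t)‖_∞ = 0 profile by profile. For
profiles whose ideal-gas development is global or breaks by a non-degenerate shock (Luk–Speck /
Buckmaster–Shkoller–Vicol open sets) this is stability of shock formation under an O(σ³)
equation-of-state and data perturbation; in general it is a σ-uniform density bound at the FIRST
singularity of 3-D compressible Euler for all smooth data. [deps: EosContinuity,
LocalGibbsDensityLimit] [difficulty: open-problem] -/
@[route_item "route-AtomisticToContinuum-AthermalWard"]
def DiluteSelfConsistency : Prop :=
  ∀ η : ℝ, 0 < η → ∀ (a₀ θ₀ : Literature.MathematicalPhysics.KineticTheory.T3 → ℝ) (u₀ : Literature.MathematicalPhysics.KineticTheory.T3 → Literature.MathematicalPhysics.KineticTheory.V3), Continuous a₀ → Continuous θ₀ → Continuous u₀ → (∀ x, 0 < a₀ x) → (∀ x, 0 < θ₀ x) → ∃ σ₀ : ℝ, 0 < σ₀ ∧ ∀ σ : ℝ, 0 < σ → σ < σ₀ → ∀ (T : ℝ) (ρ θ : ℝ → Literature.MathematicalPhysics.KineticTheory.T3 → ℝ) (u : ℝ → Literature.MathematicalPhysics.KineticTheory.T3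 → Literature.MathematicalPhysics.KineticTheory.V3), Literature.MathematicalPhysics.KineticTheory.IsHardSphereEulerSolution σ T ρ u θ → ∀ Φ : (N : ℕ) → Literature.Analysis.FluidPDE.HardSphereFlow (Literature.Analysis.FluidPDE.Torus.geometry (Fin 3)) (Literature.MathematicalPhysics.KineticTheory.hsDiameter σ N) (N + 1), Literature.MathematicalPhysics.KineticTheory.TendstoHydroFieldsAt (fun N => Literature.MathematicalPhysics.KineticTheory.localGibbsLaw σ a₀ u₀ θ₀ N (Φ N)) Φ ρ u θ 0 → ∀ t ∈ Set.Ico 0 T, ∀ x, ρ t x * σ ^ 3 < η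

/-- item stmt-AtomisticToContinuum-6387 · support · rank 9 · closed · moot by None · by planner
sources: DuftyBaskaranBrey2008, GST2013, Alexander1975, CIP1994
[support] MASTER IDENTITY (H) at the level of laws: for σ > 0, c > 0, t ≥ 0, continuous profiles
with θ₀ > 0, every N and flow Φ: lawAt Φ (localGibbsLaw σ a₀ (c·u₀) (c²θ₀) N Φ) t = (S_c)_# lawAt Φ
(localGibbsLaw σ a₀ u₀ θ₀ N Φ) (c t), S_c(x_i,v_i) = (x_i, c v_i) — "a hotter copy at time t is the
original at time ct". Proof: (S_c)_# LG(a,u,θ) = LG(a,cu,c²θ) (Gaussian change of variables; the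
configurational factor Π a(x_i)·1_D and Z_N are untouched) and Φ_t ∘ S_c = S_c ∘ Φ_{ct}
Liouville-a.e. (S_c maps hard-sphere trajectories to time-rescaled ones: free flight is linear,
contact / incoming conditions and collidePair are 1-homogeneous in the velocities;
IsHardSphereTrajectory.unique_holds on good ∩ S_c⁻¹good, conull since S_c preserves Liouville-null
sets). Rests on PROVED cone facts only. [difficulty: provable-now] -/
@[route_item "route-AtomisticToContinuum-AthermalWard"]
def ScalingCovariance : Prop :=
  ∀ (σ c t : ℝ), 0 < σ → 0 < c → 0 ≤ t → ∀ (a₀ θ₀ : Literature.MathematicalPhysics.KineticTheory.T3 → ℝ) (u₀ : Literature.MathematicalPhysics.KineticTheory.T3 → Literature.MathematicalPhysics.KineticTheory.V3), Continuous a₀ → Continuous θ₀ → Continuous u₀ → (∀ x, 0 < θ₀ x) → ∀ (N : ℕ) (Φ : Literature.Analysis.FluidPDE.HardSphereFlow (Literature.Analysis.FluidPDE.Torus.geometry (Fin 3)) (Literature.MathematicalPhysics.KineticTheory.hsDiameter σ N) (N + 1)), Φ.lawAt (Literature.MathematicalPhysics.KineticTheory.localGibbsLaw σ a₀ (fun x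 => c • u₀ x) (fun x => c ^ 2 * θ₀ x) N Φ) t = (Φ.lawAt (Literature.MathematicalPhysics.KineticTheory.localGibbsLaw σ a₀ u₀ θ₀ N Φ) (c * t)).map (fun (z : Literature.Analysis.FluidPDE.Config (N + 1) (Fin 3) Literature.MathematicalPhysics.KineticTheory.T3) (i : Fin (N + 1)) => ((z i).1, c • (z i).2))

/-- item stmt-AtomisticToContinuum-6388 · support · rank 9 · closed · moot by None · by planner
sources: DuftyBaskaranBrey2008, LebowitzPercusVerlet1967, Glynn1990, Spohn1991
[support] WARD IDENTITIES (W_H) at finite N, derivative form: for σ > 0, t > 0, continuous positive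
profiles, N, Φ and continuous χ, with P = localGibbsLaw σ a₀ u₀ θ₀ N Φ and K(z) = Σ_i[(|v_i|² −
⟪v_i,u₀(x_i)⟫)/θ₀(x_i) − 3]: s ↦ E_P⟨n_N(Φ_s z),χ⟩ has derivative t⁻¹Cov_P(K, ⟨n_N(Φ_t ·),χ⟩) at t;
s ↦ s·E_P⟨m_N(Φ_s ·),χ⟩_j has derivative Cov_P(K, ⟨m_N(Φ_t ·),χ⟩_j) at t (each j); s ↦
s²·E_P⟨e_N(Φ_s ·),χ⟩ has derivative t·Cov_P(K, ⟨e_N(Φ_t ·),χ⟩) at t — i.e. t∂_tV + D′V = Cov(·, K).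
Proof: expectations of the (0,1,2)-homogeneous fields in ScalingCovariance give
E_{LG(a,cu,c²θ)}F(U(t)) = E_{LG}F(D_cU(ct)); the left side is an exponential family in c
(differentiate under ∫: Gaussian tails × energy-bounded fields), its c-derivative at 1 is the
covariance with the score K; the right side gives D′V(t) + t∂_tV(t), and differentiability of V in t
> 0 comes for free because t enters only through c. [difficulty: provable-now] -/
@[route_item "route-AtomisticToContinuum-AthermalWard"]
def WardIdentity : Prop :=
  ∀ (σ t : ℝ), 0 < σ → 0 < t → ∀ (a₀ θ₀ : Literature.MathematicalPhysics.KineticTheory.T3 → ℝ) (u₀ : Literature.MathematicalPhysics.KineticTheory.T3 → Literature.MathematicalPhysics.KineticTheory.V3), Continuous a₀ → Continuous θ₀ → Continuous u₀ → (∀ x, 0 < a₀ x) → (∀ x, 0 < θ₀ x) → ∀ (N : ℕ) (Φ : Literature.Analysis.FluidPDE.HardSphereFlow (Literature.Analysis.FluidPDE.Torus.geometry (Fin 3)) (Literature.MathematicalPhysics.KineticTheory.hsDiameter σ N) (N + 1)) (χ : Literature.MathematicalPhysics.KineticTheory.T3 → ℝ), Continuous χ → let P : MeasureTheory.Measure (Literature.Analysis.FluidPDE.Config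 (N + 1) (Fin 3) Literature.MathematicalPhysics.KineticTheory.T3) := Literature.MathematicalPhysics.KineticTheory.localGibbsLaw σ a₀ u₀ θ₀ N Φ; let K : Literature.Analysis.FluidPDE.Config (N + 1) (Fin 3) Literature.MathematicalPhysics.KineticTheory.T3 → ℝ := fun z => ∑ i, ((‖(z i).2‖ ^ 2 - ⟪(z i).2, u₀ (z i).1⟫_ℝ) / θ₀ (z i).1 - 3); HasDerivAt (fun s : ℝ => ∫ z, Literature.MathematicalPhysics.KineticTheory.empiricalDensityField (Φ.flow s z) χ ∂P) (t⁻¹ * ProbabilityTheory.covariance K (fun z => Literature.MathematicalPhysics.KineticTheory.empiricalDensityField (Φ.flow t z) χ) P) t ∧ (∀ j : Fin 3, HasDerivAt (fun s : ℝ => s * ∫ z, Literature.MathematicalPhysics.KineticTheory.empiricalMomentumField (Φ.flow s z) χ j ∂P) (ProbabilityTheory.covariance K (fun z => Literature.MathematicalPhysics.KineticTheory.empiricalMomentumField (Φ.flow t z) χ j) P) t) ∧ HasDerivAt (fun s : ℝ => s ^ 2 * ∫ z, Literature.MathematicalPhysics.KineticTheory.empiricalEnergyField (Φ.flow s z) χ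 ∂P) (t * ProbabilityTheory.covariance K (fun z => Literature.MathematicalPhysics.KineticTheory.empiricalEnergyField (Φ.flow t z) χ) P) t

/-- item stmt-AtomisticToContinuum-6389 · support · rank 9 · closed · moot by None · by planner
sources: Spohn1991, GST2013, IrvingKirkwood1950
[support] exact MEAN continuity equation at finite N (no collision term ever enters the mass flux):
for σ > 0, continuous positive profiles, N, Φ and smooth χ, with P the local Gibbs law: h(s) := E_P
Σ_j⟨m_N(Φ_s z), ∂_jχ⟩_j is continuous on [0,∞) and s ↦ E_P⟨n_N(Φ_s z),χ⟩ has derivative h(t) within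
[0,∞) at every t ≥ 0. Proof: positions are continuous and piecewise free (IsHardSphereTrajectory:
pos_continuous, free, locFinite), so pathwise ⟨n_N(Φ_t z),χ⟩ − ⟨n_N(z),χ⟩ = ∫₀^t Σ_j⟨m_N(Φ_s
z),∂_jχ⟩_j ds for good z with integrand bounded by ‖∇χ‖_∞(2⟨e_N(z),1⟩)^{1/2} (energy conservation,
configEnergy_eq_holds; Cauchy–Schwarz); dominated convergence of difference quotients; continuity of
h because a collision at a FIXED time has probability 0 (contact sets are Liouville-null, Φ_s is
measure preserving). [difficulty: provable-now] -/
@[route_item "route-AtomisticToContinuum-AthermalWard"]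
def MeanMassContinuity : Prop :=
  ∀ σ : ℝ, 0 < σ → ∀ (a₀ θ₀ : Literature.MathematicalPhysics.KineticTheory.T3 → ℝ) (u₀ : Literature.MathematicalPhysics.KineticTheory.T3 → Literature.MathematicalPhysics.KineticTheory.V3), Continuous a₀ → Continuous θ₀ → Continuous u₀ → (∀ x, 0 < a₀ x) → (∀ x, 0 < θ₀ x) → ∀ (N : ℕ) (Φ : Literature.Analysis.FluidPDE.HardSphereFlow (Literature.Analysis.FluidPDE.Torus.geometry (Fin 3)) (Literature.MathematicalPhysics.KineticTheory.hsDiameter σ N) (N + 1)) (χ : Literature.MathematicalPhysics.KineticTheory.T3 → ℝ), Literature.Analysis.FunctionSpaces.Torus.IsSmooth χ → let P : MeasureTheory.Measure (Literature.Analysis.FluidPDE.Config (N + 1) (Fin 3) Literature.MathematicalPhysics.KineticTheory.T3) := Literature.MathematicalPhysics.KineticTheory.localGibbsLaw σ a₀ u₀ θ₀ N Φ; let h : ℝ → ℝ := fun s => ∫ z, ∑ j : Fin 3, Literature.MathematicalPhysics.KineticTheory.empiricalMomentumField (Φ.flow s z) (fun x => Literature.Analysis.FunctionSpaces.Torus.partialDeriv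 j χ x) j ∂P; ContinuousOn h (Set.Ici 0) ∧ ∀ t : ℝ, 0 ≤ t → HasDerivWithinAt (fun s : ℝ => ∫ z, Literature.MathematicalPhysics.KineticTheory.empiricalDensityField (Φ.flow s z) χ ∂P) (h t) (Set.Ici 0) t

/-- item stmt-AtomisticToContinuum-6390 · support · rank 9 · closed · moot by None · by planner
sources: Ruelle1969, GST2013, Spohn1991
[support] for continuous positive profiles and 0 < σ < 1/2: every localGibbsLaw σ a₀ u₀ θ₀ N Φ is a
probability measure (Z_N > 0: N+1 centres of spheres of diameter σ(N+1)^{-1/3} fit on a cubic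
lattice of mesh ⌈(N+1)^{1/3}⌉⁻¹ > diameter with slack, a₀ > 0 continuous), and the mean kinetic
energy per particle E⟨e_N,1⟩ is finite and ≤ C := sup|u₀|²/2 + (3/2)sup θ₀ uniformly in N and Φ
(velocities are conditionally independent Maxwellians M_{u₀(x_i),θ₀(x_i)} given the positions).
Supplies IsProbabilityMeasure and the uniform L¹/UI bounds the Assembly needs; strengthens the
satisfiability half of Literature fact localGibbs_lln. [difficulty: provable-now] -/
@[route_item "route-AtomisticToContinuum-AthermalWard"]
def LocalGibbsStatics : Prop :=
  ∀ (a₀ θ₀ : Literature.MathematicalPhysics.KineticTheory.T3 → ℝ) (u₀ : Literature.MathematicalPhysics.KineticTheory.T3 → Literature.MathematicalPhysics.KineticTheory.V3), Continuous a₀ → Continuous θ₀ → Continuous u₀ → (∀ x, 0 < a₀ x) → (∀ x, 0 < θ₀ x) → ∀ σ : ℝ, 0 < σ → σ < 2⁻¹ → ∃ C : ℝ, ∀ (N : ℕ) (Φ : Literature.Analysis.FluidPDE.HardSphereFlow (Literature.Analysis.FluidPDE.Torus.geometry (Fin 3)) (Literature.MathematicalPhysics.KineticTheory.hsDiameter σ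 N) (N + 1)), MeasureTheory.IsProbabilityMeasure (Literature.MathematicalPhysics.KineticTheory.localGibbsLaw σ a₀ u₀ θ₀ N Φ) ∧ MeasureTheory.Integrable (fun z => Literature.MathematicalPhysics.KineticTheory.empiricalEnergyField z (fun _ => 1)) (Literature.MathematicalPhysics.KineticTheory.localGibbsLaw σ a₀ u₀ θ₀ N Φ) ∧ ∫ z, Literature.MathematicalPhysics.KineticTheory.empiricalEnergyField z (fun _ => 1) ∂(Literature.MathematicalPhysics.KineticTheory.localGibbsLaw σ a₀ u₀ θ₀ N Φ) ≤ C

/-- item stmt-AtomisticToContinuum-6391 · support · rank 9 · closed · moot by None · by planner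
sources: LebowitzPercusVerlet1967, DoyonEtAl2023, DoyonEtAl2023PRL, Glynn1990
[support] CLOCK MODE, exact at finite N (card use (2)): for isothermal data at rest (u₀ ≡ 0, θ₀ ≡ θc
> 0, any continuous a₀ > 0 — e.g. a density pulse), σ > 0, t > 0, N, Φ, continuous χ, P the local
Gibbs law: (2/θc)(N+1)·Cov_P(⟨n_N(Φ_t z),χ⟩, ⟨e_N(Φ_t z),1⟩) = t·(d/dt)E_P⟨n_N(Φ_t z),χ⟩ — the
EQUAL-TIME covariance of the local density with the total kinetic energy per particle equals
(θc/2N)·t·∂_t of the mean density: the total-energy fluctuation is a random clock rate. From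
WardIdentity (density clause) with K = (2/θc)(N+1)⟨e_N,1⟩ − 3(N+1) for these profiles and
conservation of ⟨e_N,1⟩ along the flow (a.e.). Corollary left to tenure: under the conjunct the
right side → (θc/2)t∂_t∫χρ_t (t × mean mass flux), an O(1/N) LONG-RANGE density–energy correlation
growing linearly in t, present for canonical and absent for microcanonical local Gibbs data — an
EOS-free event-driven-MD test of the conjunct and an ensemble-dependent mode any BMFT-type
fluctuation target for hard spheres must carry. [difficulty: provable-now] -/
@[route_item "route-AtomisticToContinuum-AthermalWard"]
def ClockIdentity : Prop :=
  ∀ (σ θc t : ℝ), 0 < σ → 0 < θc → 0 < t → ∀ (a₀ : Literature.MathematicalPhysics.KineticTheory.T3 → ℝ), Continuous a₀ → (∀ x, 0 < a₀ x) → ∀ (N : ℕ) (Φ : Literature.Analysis.FluidPDE.HardSphereFlow (Literature.Analysis.FluidPDE.Torus.geometry (Fin 3)) (Literature.MathematicalPhysics.KineticTheory.hsDiameter σ N) (N + 1)) (χ : Literature.MathematicalPhysics.KineticTheory.T3 → ℝ), Continuous χ → let P : MeasureTheory.Measure (Literature.Analysis.FluidPDE.Config (N + 1) (Fin 3) Literature.MathematicalPhysics.KineticTheory.T3)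 := Literature.MathematicalPhysics.KineticTheory.localGibbsLaw σ a₀ (fun _ => 0) (fun _ => θc) N Φ; 2 / θc * ((N : ℝ) + 1) * ProbabilityTheory.covariance (fun z => Literature.MathematicalPhysics.KineticTheory.empiricalDensityField (Φ.flow t z) χ) (fun z => Literature.MathematicalPhysics.KineticTheory.empiricalEnergyField (Φ.flow t z) (fun _ => 1)) P = t * deriv (fun s : ℝ => ∫ z, Literature.MathematicalPhysics.KineticTheory.empiricalDensityField (Φ.flow s z) χ ∂P) t

/-- item stmt-AtomisticToContinuum-6392 · assembly · rank 1 · closed · moot by None · by planner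
sources: Spohn1991, OllaVaradhanYau1993
[assembly] OneDirectionResponse → MeanClosure → DiluteSelfConsistency → WardIdentity →
MeanMassContinuity → LocalGibbsStatics → HydrodynamicLimit (the Assembly factors through the target
MeanHydroLimitInBand; ScalingCovariance feeds WardIdentity; ClockIdentity is the negative-side / MD
handle and is not used). -/
@[route_item "route-AtomisticToContinuum-AthermalWard"]
def Assembly : Prop :=
  OneDirectionResponse → MeanClosure → DiluteSelfConsistency → WardIdentity → MeanMassContinuity → LocalGibbsStatics → Literature.MathematicalPhysics.KineticTheory.HydrodynamicLimit

end Summit.AtomisticToContinuum.HydrodynamicLimit.Theses.AthermalWard
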